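import Literature.Computability.Cryptography.ChenQuantumLWEStepEight
import Mathlib.Analysis.Matrix.Order

/-!
# Chen 2024 (withdrawn), Step 8: the information ceiling for GENERAL measurements (POVMs)

REPRODUCTION / ANALYSIS OF A CLAIMED RESULT UNDER ADJUDICATION — header required by the tree's literature
rule.  Author: Yilei Chen.  Title: *Quantum Algorithms for Lattice Problems*.  Venue: IACR Cryptology ePrint
Archive, Paper 2024/555, version of 18 April 2024 (the main claim WITHDRAWN by the author, title-page note;
the bug is in Step 9, p. 37). [ChenQuantumLattice2024]  Printed page numbers.

HONEST FRAMING (bundle `papers/QuantumAdvantage/lwe-quantum-autopsy/`, Part 1): the value of this file is a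
THEOREM / DECIDABLE VERDICT about a withdrawn algorithm — a precise negative result about one of its steps —
NOT summit progress, no cryptanalytic claim in either direction.

WHAT IS DONE HERE.  `ChenQuantumLWEStepEight.lean` performs Step 8 (§3.5.8, pp. 32–34) on the registers and
proves the STEP-8 CEILING for every read-out OF THE COMPUTATIONAL-BASIS OUTCOME `w` of `|φ7.d⟩`
(`Shape.step8_information_ceiling`: a non-demolition statistic `F(w)` depends on the unknown offset only
through `v′₀ mod D²p₁ = step8Output`, so it cannot supply `step9Needs = v′₀ mod D²P`).  Its docstring
records the scope caveat "general instruments / POVMs not diagonal in the `w` basis are NOT modelled".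
This file REMOVES that caveat.  A general measurement is a POVM `(E_k)_k` on the Step-8 register
`ℤ_M^{n+1}` (`POVM`: effects `E_k ≥ 0`, `Σ_k E_k = 1`; Born weight `⟨ψ|E_k|ψ⟩`); Lemma 3.13 requires the
fifth operation of Step 8 to return `|φ8⟩ = |φ7⟩`, i.e. its outcome must be CERTAIN (`POVM.Certain`) on the
state of every instance the algorithm may face.  We prove:

* `POVM.eq_of_certain_of_dotProduct_ne_zero` — the one-line mechanism: outcomes that are certain on two
  NON-ORTHOGONAL states coincide (`⟨ψ|φ⟩ = ⟨ψ|E_{k′}|φ⟩ = ⟨E_{k′}ψ|φ⟩ = 0` otherwise; `E ≥ 0`, `ΣE = 1`).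
  Computational read-outs are the special case `POVM.readout` (`Shape.sureOn_readout_of_nonDemolition`).
* Three explicit NON-ORTHOGONALITY MOVES between the states `|φ7.d(b,v′)⟩` of admissible instances
  (`Shape.inst`, same public `n, D, p₁, Q`), each proved by a RIGIDITY of coinciding branches of `|φ7⟩`
  (eq. (35): points `2D²j·b + v′ + (M/2)k`, amplitudes `e(−j²/P)e(‖k‖²/4)`) — at every common support point
  the product `conj(amp)·amp′` takes ONE unimodular value `ζ`, so `⟨φ7|φ7′⟩ = ζ·#(common points) ≠ 0` — and
  transported through Step 8's operations (`⟨φ7.d|φ7.d′⟩ = M^{n+1}⟨φ7.b|φ7.b′⟩`, polarised Plancherel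
  `dotProduct_qft_qft`, the kick is unimodular, and `|φ7.b⟩(y) = |φ7⟩(D·y)`):
  (A) `Shape.dot_phi7d_ne_zero_same_offset`: same `v′`, ANY two admissible `b` (branch `j = 0` is common —
  the secret is invisible there); (T) `Shape.dot_phi7d_ne_zero_moveT`: `(b, v′) ~ (b − 2p₁m, v′ + 4D²p₁m)`
  for `m ∈ 0|ℤⁿ` (branch `j = 1` common); (C) `Shape.dot_phi7d_ne_zero_moveC`:
  `(b, v′) ~ (b − 2p₁e_i, v′ + 2D²p₁a·b)` — the move that CHANGES `v′₀` (by `−2D²p₁a`): coordinate `0`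
  forces `j ≡ j′ + p₁a (mod P)`, coordinate `i` forces `Q ∣ j′`, whence `ζ = e(p₁a²/Q)`.
* `Shape.step8_povm_ceiling` — **the general-measurement ceiling.**  Fix the public data and a set `U` of
  coordinates on which `b` is unknown, containing some `i ≥ 1` (in Chen's eq. (12) the secret and error
  coordinates).  If a POVM has a certain outcome on `|φ7.d(b₂,v₂)⟩` for every admissible instance with
  `b₂ = b` off `U` (`Shape.SureOn`), then that outcome is the same for `(b₂, v₂)` and `(b₃, v₃)` whenever
  `v₃ ≡ v₂ + 2D²p₁(a·b₂ + m) (mod M)` with `a ∈ ℤ`, `m ∈ ℤ^{n+1}` supported on `U ∖ {0}` — for ANY `b₃` of the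
  class.  In particular (`Shape.step8_cannot_supply_step9Needs_povm`, `…_povm'` for the full class of
  `step8_information_ceiling`) there is an admissible instance with the SAME `b`, the same `step8Output` and
  a DIFFERENT `step9Needs` on which every such measurement returns the same certain outcome as on `S`:
  no fifth operation whatsoever — computational read-out, POVM, instrument (an instrument that returns
  `|φ7⟩` intact has a certain classical outcome, which is all that is used) — makes Step 8 deliver what
  Step 9 consumes.  This closes the modelling caveat of `step8_information_ceiling` and is the Step-8
  counterpart of Part 2's class-twirl statement for Step 9 (`ChenQuantumLWEClassTwirl.lean`).

SHARPNESS (remark, checked by brute force in the bundle's `numerics/step8_povm/components.py` on seven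
parameter sets incl. `(D,p₁,Q,n) = (7,5,9,1)` and `(1,3,35,3)` with two planted coordinates, not
formalised): the orbit above is the whole story —
`Φ = (v′ mod 2D²p₁ on the coordinates {0} ∪ U;  v′_i + b_i·v′₀ mod M on the known coordinates i ∉ U)`
is a complete invariant: instances with different `Φ` have ORTHOGONAL `|φ7.d⟩` (so a projective
measurement does learn `Φ` with certainty — on coordinate `0` one bit more than Chen's
`v′₀ mod D²p₁`, and nothing of `v′₀ mod Q`), and each level set of `Φ` is exactly one orbit of the moves
A/T/C, i.e. one non-orthogonality component.

Everything is `sorry`-free over Mathlib (`Matrix.PosSemidef`, `Matrix.PosSemidef.dotProduct_mulVec_zero_iff`).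
-/

namespace Literature.Computability.Cryptography.Chen2024

open scoped BigOperators ComplexOrder
open Matrix

/-! ### General measurements (POVMs) and certain outcomes -/

/-- A general measurement (POVM) on the register with computational basis `X`, outcomes in `κ`: effects
`E_k ≥ 0` with `Σ_k E_k = 1`; the (unnormalised) Born weight of outcome `k` on a state `ψ` is `⟨ψ|E_k|ψ⟩`.
[cite: NielsenChuang2010, §2.2.6 p. 90] -/
structure POVM (X κ : Type*) [Fintype X] [DecidableEq X] [Fintype κ] where
  /-- the effect of outcome `k` -/
  effect : κ → Matrix X X ℂ
  /-- effects are positive semidefinite -/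
  posSemidef : ∀ k, (effect k).PosSemidef
  /-- effects sum to the identity -/
  sum_eq_one : ∑ k, effect k = 1

namespace POVM

variable {X κ : Type*} [Fintype X] [DecidableEq X] [Fintype κ] (E : POVM X κ)

/-- Born weight (unnormalised) of outcome `k` on `ψ`: `⟨ψ|E_k|ψ⟩`. [cite: NielsenChuang2010, §2.2.6 p. 90] -/
def weight (ψ : X → ℂ) (k : κ) : ℂ := star ψ ⬝ᵥ (E.effect k *ᵥ ψ)

/-- Outcome `k` is CERTAIN on `ψ`: it carries the whole weight `⟨ψ|ψ⟩` (probability one when `ψ ≠ 0`).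
[cite: NielsenChuang2010, §2.2.6 p. 90] -/
def Certain (ψ : X → ℂ) (k : κ) : Prop := E.weight ψ k = star ψ ⬝ᵥ ψ

/-- The weights sum to `⟨ψ|ψ⟩`. [cite: NielsenChuang2010, §2.2.6 p. 90] -/
theorem sum_weight (ψ : X → ℂ) : ∑ k, E.weight ψ k = star ψ ⬝ᵥ ψ := by
  unfold weight
  rw [← dotProduct_sum]
  congr 1
  rw [← Matrix.sum_mulVec, E.sum_eq_one, Matrix.one_mulVec]

/-- Weights are non-negative. [cite: NielsenChuang2010, §2.2.6 p. 90] -/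
theorem weight_nonneg (ψ : X → ℂ) (k : κ) : 0 ≤ E.weight ψ k :=
  (E.posSemidef k).dotProduct_mulVec_nonneg ψ

/-- If `k` is certain on `ψ`, every other effect annihilates `ψ`. [cite: NielsenChuang2010, §2.2.6 p. 90] -/
theorem mulVec_eq_zero_of_certain [DecidableEq κ] {ψ : X → ℂ} {k : κ} (h : E.Certain ψ k) {l : κ}
    (hl : l ≠ k) : E.effect l *ᵥ ψ = 0 := by
  have hsum : ∑ l ∈ Finset.univ.erase k, E.weight ψ l = 0 := by
    have := E.sum_weight ψ
    rw [← Finset.add_sum_erase _ _ (Finset.mem_univ k)] at this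
    unfold Certain at h
    rw [h] at this
    exact add_left_cancel (a := star ψ ⬝ᵥ ψ) (by rw [this, add_zero])
  have hl0 : E.weight ψ l = 0 :=
    (Finset.sum_eq_zero_iff_of_nonneg fun l _ => E.weight_nonneg ψ l).1 hsum l
      (Finset.mem_erase.2 ⟨hl, Finset.mem_univ l⟩)
  exact ((E.posSemidef l).dotProduct_mulVec_zero_iff ψ).1 hl0

/-- If `k` is certain on `ψ` then `E_k ψ = ψ`. [cite: NielsenChuang2010, §2.2.6 p. 90] -/
theorem mulVec_eq_self_of_certain [DecidableEq κ] {ψ : X → ℂ} {k : κ} (h : E.Certain ψ k) :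
    E.effect k *ᵥ ψ = ψ := by
  have h1 : ∑ l, E.effect l *ᵥ ψ = ψ := by
    rw [← Matrix.sum_mulVec, E.sum_eq_one, Matrix.one_mulVec]
  rw [← Finset.add_sum_erase _ _ (Finset.mem_univ k)] at h1
  rw [Finset.sum_eq_zero (fun l hl => E.mulVec_eq_zero_of_certain h (Finset.mem_erase.1 hl).1), add_zero] at h1
  exact h1

/-- **Certain outcomes of non-orthogonal states coincide.**  If outcome `k` is certain on `ψ`, outcome `k′` is
certain on `φ`, and `⟨ψ|φ⟩ ≠ 0`, then `k = k′` (`⟨ψ|φ⟩ = ⟨ψ|E_{k′}|φ⟩ = ⟨E_{k′}ψ|φ⟩ = 0` otherwise). This is the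
one-line reason non-orthogonal states cannot be distinguished with certainty by ANY measurement.
[cite: NielsenChuang2010, Box 2.3 p. 87] -/
theorem eq_of_certain_of_dotProduct_ne_zero [DecidableEq κ] {ψ φ : X → ℂ} {k k' : κ}
    (hψ : E.Certain ψ k) (hφ : E.Certain φ k') (hne : star ψ ⬝ᵥ φ ≠ 0) : k = k' := by
  by_contra hkk
  apply hne
  have h0 : E.effect k' *ᵥ ψ = 0 := E.mulVec_eq_zero_of_certain hψ (Ne.symm hkk)
  have hH : (E.effect k')ᴴ = E.effect k' := (E.posSemidef k').isHermitian
  calc star ψ ⬝ᵥ φ = star ψ ⬝ᵥ (E.effect k' *ᵥ φ) := by rw [E.mulVec_eq_self_of_certain hφ]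
    _ = (star ψ ᵥ* E.effect k') ⬝ᵥ φ := (dotProduct_mulVec _ _ _)
    _ = star (E.effect k' *ᵥ ψ) ⬝ᵥ φ := by rw [star_mulVec, hH]
    _ = 0 := by rw [h0, star_zero, zero_dotProduct]

/-- In particular the certain outcome of a non-zero state is unique. [cite: NielsenChuang2010, §2.2.6 p. 90] -/
theorem certain_unique [DecidableEq κ] {ψ : X → ℂ} (hψ : ψ ≠ 0) {k k' : κ} (hk : E.Certain ψ k)
    (hk' : E.Certain ψ k') : k = k' :=
  E.eq_of_certain_of_dotProduct_ne_zero hk hk' (by rwa [Ne, dotProduct_star_self_eq_zero])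

end POVM

/-! ### Non-orthogonality from a rigid common support -/

/-- If `conj ψ(z)·φ(z)` takes ONE non-zero value `ζ` at every common support point and there is a common
support point, then `⟨ψ|φ⟩ = #(common support)·ζ ≠ 0`. [folklore] -/
theorem dotProduct_ne_zero_of_rigid {X : Type*} [Fintype X] (ψ φ : X → ℂ) {ζ : ℂ} (hζ : ζ ≠ 0)
    (hrig : ∀ z, ψ z ≠ 0 → φ z ≠ 0 → (starRingEnd ℂ) (ψ z) * φ z = ζ)
    (hwit : ∃ z, ψ z ≠ 0 ∧ φ z ≠ 0) : star ψ ⬝ᵥ φ ≠ 0 := by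
  classical
  have hpt : ∀ z, (starRingEnd ℂ) (ψ z) * φ z = if ψ z ≠ 0 ∧ φ z ≠ 0 then ζ else 0 := by
    intro z
    split_ifs with hz
    · exact hrig z hz.1 hz.2
    · rw [not_and_or, not_not, not_not] at hz
      rcases hz with hz | hz
      · rw [hz, map_zero, zero_mul]
      · rw [hz, mul_zero]
  have hsum : star ψ ⬝ᵥ φ = ((Finset.univ.filter fun z => ψ z ≠ 0 ∧ φ z ≠ 0).card : ℂ) * ζ := by
    simp only [dotProduct, Pi.star_apply, Complex.star_def, hpt]
    rw [Finset.sum_ite, Finset.sum_const_zero, add_zero, Finset.sum_const, nsmul_eq_mul]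
  rw [hsum]
  refine mul_ne_zero ?_ hζ
  obtain ⟨z, hz⟩ := hwit
  exact_mod_cast (Finset.card_pos.2 ⟨z, Finset.mem_filter.2 ⟨Finset.mem_univ z, hz⟩⟩).ne'

/-! ### Inner products through Step 8's operations -/

/-- `conj e(q) = e(−q)`. [folklore] -/
theorem conj_e (q : ℚ) : (starRingEnd ℂ) (e q) = e (-q) := by
  have h1 : (starRingEnd ℂ) (e q) * e q = 1 := by
    rw [Complex.conj_mul', norm_e]
    simp
  have h2 : e (-q) * e q = 1 := by
    rw [← e_add, neg_add_cancel]
    have h0 := e_intCast 0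
    rwa [Int.cast_zero] at h0
  have hne : e q ≠ 0 := by
    intro h
    rw [h, mul_zero] at h1
    exact zero_ne_one h1
  exact mul_right_cancel₀ hne (h1.trans h2.symm)

/-- A phase kick preserves inner products: `⟨kick g ψ | kick g φ⟩ = ⟨ψ|φ⟩`. [cite: ChenQuantumLattice2024, Lemma 2.13 p. 13] -/
theorem dotProduct_kick_kick {n m : ℕ} [NeZero m] (g : (Fin n → ZMod m) → ℚ) (ψ φ : Ket n m) :
    star (kick g ψ) ⬝ᵥ kick g φ = star ψ ⬝ᵥ φ := by
  simp only [dotProduct, Pi.star_apply, Complex.star_def, kick, map_mul]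
  refine Finset.sum_congr rfl fun z _ => ?_
  have h1 : (starRingEnd ℂ) (e (g z)) * e (g z) = 1 := by
    rw [Complex.conj_mul', norm_e]
    simp
  linear_combination ((starRingEnd ℂ) (ψ z) * φ z) * h1

/-- **Polarised Plancherel for Chen's unnormalised `QFT`:** `⟨QFT ψ | QFT φ⟩ = mⁿ·⟨ψ|φ⟩`.
[cite: ChenQuantumLattice2024, Lemma 2.12 p. 12] -/
theorem dotProduct_qft_qft {n m : ℕ} [NeZero m] (ψ φ : Ket n m) :
    star (qft ψ) ⬝ᵥ qft φ = ((m : ℂ)) ^ n * (star ψ ⬝ᵥ φ) := by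
  classical
  set χ := ZMod.stdAddChar (N := m) with hχ
  simp only [dotProduct, Pi.star_apply, Complex.star_def]
  calc ∑ u, (starRingEnd ℂ) (qft ψ u) * qft φ u
      = ∑ u : Fin n → ZMod m, ∑ z : Fin n → ZMod m, ∑ z' : Fin n → ZMod m,
          (starRingEnd ℂ) (ψ z) * φ z' * χ (∑ t, (z' t - z t) * -u t) := by
        refine Finset.sum_congr rfl fun u _ => ?_
        rw [qft_apply_eq_sum_stdAddChar, qft_apply_eq_sum_stdAddChar, map_sum, Finset.sum_mul_sum]
        refine Finset.sum_congr rfl fun z _ => Finset.sum_congr rfl fun z' _ => ?_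
        rw [map_mul, ← AddChar.map_neg_eq_conj, mul_mul_mul_comm, ← AddChar.map_add_eq_mul]
        congr 2
        rw [neg_neg, ← Finset.sum_neg_distrib, ← Finset.sum_add_distrib]
        exact Finset.sum_congr rfl fun t _ => by ring
    _ = ∑ z : Fin n → ZMod m, ∑ z' : Fin n → ZMod m, (starRingEnd ℂ) (ψ z) * φ z'
          * ∑ u : Fin n → ZMod m, χ (∑ t, (z' t - z t) * -u t) := by
        rw [Finset.sum_comm]
        refine Finset.sum_congr rfl fun z _ => ?_
        rw [Finset.sum_comm]
        refine Finset.sum_congr rfl fun z' _ => ?_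
        rw [Finset.mul_sum]
    _ = ∑ z : Fin n → ZMod m, ∑ z' : Fin n → ZMod m, (starRingEnd ℂ) (ψ z) * φ z'
          * (if z' - z = 0 then ((m : ℂ)) ^ n else 0) := by
        refine Finset.sum_congr rfl fun z _ => Finset.sum_congr rfl fun z' _ => ?_
        congr 1
        have h := sum_stdAddChar_linForm (z' - z)
        simp only [Pi.sub_apply] at h
        rw [← h]
        exact (Fintype.sum_equiv (Equiv.neg _) _ _ fun u => by simp [hχ]).symm
    _ = ((m : ℂ)) ^ n * ∑ z, (starRingEnd ℂ) (ψ z) * φ z := by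
        rw [Finset.mul_sum]
        refine Finset.sum_congr rfl fun z _ => ?_
        simp_rw [sub_eq_zero, mul_ite, mul_zero]
        rw [Finset.sum_ite_eq' Finset.univ z]
        simp only [Finset.mem_univ, if_true]
        ring



namespace Shape

variable (S : Shape)

/-! ### The points of `|φ7⟩` of an instance -/

/-- `N = D²P` as an integer. [cite: ChenQuantumLattice2024, Cond. C.3 p. 18] -/
theorem N_coe : ((S.N : ℕ) : ℤ) = (S.D : ℤ) * S.D * S.P := by
  show ((((S.D * S.D * S.P : ℕ+)) : ℕ) : ℤ) = _
  push_cast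
  ring

/-- `P = p₁Q` as an integer. [cite: ChenQuantumLattice2024, Cond. C.3 p. 18] -/
theorem P_coe : ((S.P : ℕ) : ℤ) = (S.p₁ : ℤ) * S.Q := by
  show ((((S.p₁ * S.Q : ℕ+)) : ℕ) : ℤ) = _
  push_cast
  ring

/-- `P` is odd for an admissible shape. [cite: ChenQuantumLattice2024, Cond. C.3 p. 18] -/
theorem odd_P (h : S.Admissible) : Odd (S.P : ℕ) := by
  show Odd (((S.p₁ * S.Q : ℕ+)) : ℕ)
  rw [PNat.mul_coe]
  exact h.odd_p₁.mul h.odd_Q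

/-- The point of branch `(j,k)` of `|φ7⟩` of the instance `(b, v)`, coordinatewise (eq. (35)).
[cite: ChenQuantumLattice2024, eq. (35) p. 31] -/
theorem pt7_inst_apply (b v : Fin (S.n + 1) → ℤ) (j : ℕ) (k : Fin S.n → Fin 2) (i : Fin (S.n + 1)) :
    (S.inst b v).pt7 j k i
      = ((2 * (S.D : ℤ) * j * ((S.D : ℤ) * b i) + v i + (S.N : ℤ) * S.kLift k i : ℤ) : ZMod S.M) := rfl

/-- `kLift k 0 = 0`. [cite: ChenQuantumLattice2024, eq. (35) p. 31] -/
theorem kLift_zero (k : Fin S.n → Fin 2) : S.kLift k 0 = 0 := by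
  simp [kLift]

/-- `kLift k (t+1) = k_t`. [cite: ChenQuantumLattice2024, eq. (35) p. 31] -/
theorem kLift_succ (k : Fin S.n → Fin 2) (t : Fin S.n) : S.kLift k t.succ = ((k t : ℕ) : ℤ) := by
  simp [kLift]

/-- `|φ7⟩` of an instance depends on the offset only modulo `M`. [cite: ChenQuantumLattice2024, eq. (35) p. 31] -/
theorem phi7_inst_congr (b v₂ v₃ : Fin (S.n + 1) → ℤ) (hv : ∀ i, ((v₃ i : ℤ) : ZMod S.M) = ((v₂ i : ℤ) : ZMod S.M)) :
    (S.inst b v₃).phi7 = (S.inst b v₂).phi7 := by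
  have hpt : (S.inst b v₃).pt7 = (S.inst b v₂).pt7 := by
    funext j k i
    rw [pt7_inst_apply, pt7_inst_apply]
    push_cast
    rw [hv i]
  funext z
  rw [phi7_apply, phi7_apply, hpt]
  rfl

/-! ### Coincidences of points of two instances

If a point of `|φ7(b₂,v₂)⟩` (branch `(j,k)`) equals a point of `|φ7(b₃,v₃)⟩` (branch `(j′,k′)`), the branches
are rigidly related. -/

section coincidence

variable {S}
variable {b₂ v₂ b₃ v₃ : Fin (S.n + 1) → ℤ} {j j' : ℕ} {k k' : Fin S.n → Fin 2}

/-- Coordinate `t+1` of a coincidence, as a divisibility: `M ∣ (2D²j′b₃ + v₃ + N k′) − (2D²j b₂ + v₂ + N k)`.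
[cite: ChenQuantumLattice2024, eq. (35) p. 31] -/
theorem coincidence_dvd_succ (heq : (S.inst b₂ v₂).pt7 j k = (S.inst b₃ v₃).pt7 j' k') (t : Fin S.n) :
    (2 * (S.D : ℤ) * S.D * S.P) ∣
      (2 * (S.D : ℤ) * S.D * j' * b₃ t.succ + v₃ t.succ + (S.D : ℤ) * S.D * S.P * (k' t : ℕ))
        - (2 * (S.D : ℤ) * S.D * j * b₂ t.succ + v₂ t.succ + (S.D : ℤ) * S.D * S.P * (k t : ℕ)) := by
  have hi : ((2 * (S.D : ℤ) * j * ((S.D : ℤ) * b₂ t.succ) + v₂ t.succ + (S.N : ℤ) * S.kLift k t.succ : ℤ)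
      : ZMod S.M) = ((2 * (S.D : ℤ) * j' * ((S.D : ℤ) * b₃ t.succ) + v₃ t.succ
        + (S.N : ℤ) * S.kLift k' t.succ : ℤ) : ZMod S.M) := congr_fun heq t.succ
  rw [ZMod.intCast_eq_intCast_iff_dvd_sub, S.M_coe, S.N_coe, kLift_succ, kLift_succ] at hi
  have e : ∀ (jj : ℕ) (bb vv : ℤ) (kk : ℕ),
      (2 * (S.D : ℤ) * jj * ((S.D : ℤ) * bb) + vv + (S.D : ℤ) * S.D * S.P * (kk : ℤ))
        = 2 * (S.D : ℤ) * S.D * jj * bb + vv + (S.D : ℤ) * S.D * S.P * kk := by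
    intros; ring
  rwa [e, e] at hi

/-- Coordinate `0` of a coincidence (`b₂ 0 = b₃ 0 = −1`, `k₀ = 0`): `M ∣ (v₃₀ − 2D²j′) − (v₂₀ − 2D²j)`.
[cite: ChenQuantumLattice2024, eq. (35) p. 31, eq. (12) p. 17] -/
theorem coincidence_dvd_zero (heq : (S.inst b₂ v₂).pt7 j k = (S.inst b₃ v₃).pt7 j' k')
    (hb₂ : b₂ 0 = -1) (hb₃ : b₃ 0 = -1) :
    (2 * (S.D : ℤ) * S.D * S.P) ∣ (v₃ 0 - 2 * (S.D : ℤ) * S.D * j') - (v₂ 0 - 2 * (S.D : ℤ) * S.D * j) := by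
  have hi : ((2 * (S.D : ℤ) * j * ((S.D : ℤ) * b₂ 0) + v₂ 0 + (S.N : ℤ) * S.kLift k 0 : ℤ) : ZMod S.M)
      = ((2 * (S.D : ℤ) * j' * ((S.D : ℤ) * b₃ 0) + v₃ 0 + (S.N : ℤ) * S.kLift k' 0 : ℤ) : ZMod S.M) :=
    congr_fun heq 0
  rw [ZMod.intCast_eq_intCast_iff_dvd_sub, S.M_coe, kLift_zero, kLift_zero, hb₂, hb₃] at hi
  have e : ∀ (jj : ℕ) (vv : ℤ),
      (2 * (S.D : ℤ) * jj * ((S.D : ℤ) * (-1)) + vv + (S.N : ℤ) * 0) = vv - 2 * (S.D : ℤ) * S.D * jj := by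
    intros; ring
  rwa [e, e] at hi

/-- **Rigidity of `k`.**  If the offsets differ by an element of `2D²ℤ` on the coordinates `≥ 1`, coinciding
branches have the same `k` (reduce coordinate `t+1` modulo `2D²`: `2D² ∣ D²P(k′_t − k_t)` with `P` odd).
[cite: ChenQuantumLattice2024, eq. (35) p. 31, Cond. C.3 p. 18] -/
theorem coincidence_k (hP : Odd (S.P : ℕ)) (heq : (S.inst b₂ v₂).pt7 j k = (S.inst b₃ v₃).pt7 j' k')
    (hδ : ∀ t : Fin S.n, (2 * (S.D : ℤ) * S.D) ∣ v₃ t.succ - v₂ t.succ) : k = k' := by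
  funext t
  obtain ⟨q, hq⟩ := coincidence_dvd_succ heq t
  obtain ⟨η, hη⟩ := hδ t
  obtain ⟨r, hr⟩ := hP
  have hD : (S.D : ℤ) * S.D ≠ 0 := by
    have : (S.D : ℤ) ≠ 0 := by exact_mod_cast S.D.ne_zero
    exact mul_ne_zero this this
  -- `P (k′ − k) = 2 X`
  have hX : ((S.P : ℕ) : ℤ) * ((k' t : ℕ) - (k t : ℕ) : ℤ)
      = 2 * (S.P * q - j' * b₃ t.succ + j * b₂ t.succ - η) := by
    have e1 : (S.D : ℤ) * S.D * (((S.P : ℕ) : ℤ) * ((k' t : ℕ) - (k t : ℕ) : ℤ))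
        = (S.D : ℤ) * S.D * (2 * (S.P * q - j' * b₃ t.succ + j * b₂ t.succ - η)) := by
      linear_combination hq - hη
    exact mul_left_cancel₀ hD e1
  have hP' : ((S.P : ℕ) : ℤ) = 2 * r + 1 := by exact_mod_cast hr
  have hd : ((k' t : ℕ) - (k t : ℕ) : ℤ)
      = 2 * ((S.P * q - j' * b₃ t.succ + j * b₂ t.succ - η) - r * ((k' t : ℕ) - (k t : ℕ) : ℤ)) := by
    linear_combination hX - (((k' t : ℕ) : ℤ) - ((k t : ℕ) : ℤ)) * hP'
  have h1 := (k t).isLt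
  have h2 := (k' t).isLt
  apply Fin.ext
  omega

/-- **Rigidity of `j` (head).**  With `v₃₀ − v₂₀ = 2D²Δ₀`: coinciding branches satisfy `j′ ≡ j + Δ₀ (mod P)`.
[cite: ChenQuantumLattice2024, eq. (35) p. 31, eq. (12) p. 17] -/
theorem coincidence_head (heq : (S.inst b₂ v₂).pt7 j k = (S.inst b₃ v₃).pt7 j' k')
    (hb₂ : b₂ 0 = -1) (hb₃ : b₃ 0 = -1) (Δ₀ : ℤ) (hΔ : v₃ 0 - v₂ 0 = 2 * (S.D : ℤ) * S.D * Δ₀) :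
    ((S.P : ℕ) : ℤ) ∣ (j' : ℤ) - j - Δ₀ := by
  obtain ⟨q, hq⟩ := coincidence_dvd_zero heq hb₂ hb₃
  have hD : (2 * (S.D : ℤ) * S.D) ≠ 0 := by
    have : (S.D : ℤ) ≠ 0 := by exact_mod_cast S.D.ne_zero
    positivity
  refine ⟨-q, mul_left_cancel₀ hD ?_⟩
  linear_combination hΔ - hq

/-- **Rigidity of `j` (tail).**  On a coordinate `t+1` where `v₃ − v₂ = 2D²η` and `k′_t = k_t`:
`P ∣ j b₂ − j′ b₃ − η`. [cite: ChenQuantumLattice2024, eq. (35) p. 31] -/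
theorem coincidence_tail (heq : (S.inst b₂ v₂).pt7 j k = (S.inst b₃ v₃).pt7 j' k') (t : Fin S.n)
    (hk : k t = k' t) (η : ℤ) (hη : v₃ t.succ - v₂ t.succ = 2 * (S.D : ℤ) * S.D * η) :
    ((S.P : ℕ) : ℤ) ∣ (j : ℤ) * b₂ t.succ - j' * b₃ t.succ - η := by
  obtain ⟨q, hq⟩ := coincidence_dvd_succ heq t
  rw [hk] at hq
  have hD : (2 * (S.D : ℤ) * S.D) ≠ 0 := by
    have : (S.D : ℤ) ≠ 0 := by exact_mod_cast S.D.ne_zero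
    positivity
  refine ⟨-q, mul_left_cancel₀ hD ?_⟩
  linear_combination hη - hq

end coincidence

/-! ### Support and values of `|φ7⟩` -/

/-- Within one admissible instance, `(j,k) ↦ pt7 j k` is injective on `j ∈ [0,P)`.
[cite: ChenQuantumLattice2024, eq. (35) p. 31] -/
theorem pt7_inj (h : S.Admissible) {j j' : ℕ} (hj : j < (S.P : ℕ)) (hj' : j' < (S.P : ℕ)) {k k' : Fin S.n → Fin 2}
    (heq : S.pt7 j k = S.pt7 j' k') : j = j' ∧ k = k' := by
  have heq' : (S.inst S.b S.v').pt7 j k = (S.inst S.b S.v').pt7 j' k' := heq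
  have hk : k = k' := coincidence_k (S.odd_P h) heq' fun t => ⟨0, by ring⟩
  refine ⟨?_, hk⟩
  obtain ⟨c, hc⟩ := coincidence_head heq' h.b_head h.b_head 0 (by ring)
  have hP : (0 : ℤ) < (S.P : ℕ) := by exact_mod_cast S.P.pos
  have hj1 : (j : ℤ) < (S.P : ℕ) := by exact_mod_cast hj
  have hj2 : (j' : ℤ) < (S.P : ℕ) := by exact_mod_cast hj'
  rcases lt_trichotomy c 0 with hc0 | hc0 | hc0
  · nlinarith
  · rw [hc0, mul_zero] at hc
    omega
  · nlinarith

/-- The value of `|φ7⟩` at its point of branch `(j,k)` is the amplitude `e(−j²/P)e(‖k‖²/4)` (the points are distinct).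
[cite: ChenQuantumLattice2024, eq. (35) p. 31] -/
theorem phi7_apply_pt7 (h : S.Admissible) {j : ℕ} (hj : j < (S.P : ℕ)) (k : Fin S.n → Fin 2) :
    S.phi7 (S.pt7 j k) = S.amp7 j k := by
  classical
  rw [phi7_apply, Finset.sum_eq_single_of_mem j (Finset.mem_range.2 hj)]
  · rw [Fintype.sum_eq_single k]
    · rw [if_pos rfl]
    · intro k' hk'
      rw [if_neg]
      intro habs
      exact hk' ((S.pt7_inj h hj hj habs).2).symm
  · intro j' hj' hne
    refine Finset.sum_eq_zero fun k' _ => ?_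
    rw [if_neg]
    intro habs
    exact hne ((S.pt7_inj h hj (Finset.mem_range.1 hj') habs).1).symm

/-- A point where `|φ7⟩` does not vanish is the point of some branch `(j,k)`, `j ∈ [0,P)`.
[cite: ChenQuantumLattice2024, eq. (35) p. 31] -/
theorem exists_branch_of_phi7_ne_zero {z : Fin (S.n + 1) → ZMod S.M} (hz : S.phi7 z ≠ 0) :
    ∃ j : ℕ, j < (S.P : ℕ) ∧ ∃ k, z = S.pt7 j k := by
  rw [phi7_apply] at hz
  obtain ⟨j, hj, hne⟩ := Finset.exists_ne_zero_of_sum_ne_zero hz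
  obtain ⟨k, -, hne'⟩ := Finset.exists_ne_zero_of_sum_ne_zero hne
  refine ⟨j, Finset.mem_range.1 hj, k, ?_⟩
  by_contra hzk
  exact hne' (if_neg hzk)

/-- The amplitudes are unimodular, hence non-zero. [cite: ChenQuantumLattice2024, eq. (35) p. 31] -/
theorem amp7_ne_zero (j : ℕ) (k : Fin S.n → Fin 2) : S.amp7 j k ≠ 0 := by
  unfold amp7 e
  exact mul_ne_zero (Complex.exp_ne_zero _) (Complex.exp_ne_zero _)

end Shape


namespace Shape

variable (S : Shape)

/-! ### The amplitude products at coinciding branches -/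

/-- `P = p₁Q` as a rational. [cite: ChenQuantumLattice2024, Cond. C.3 p. 18] -/
theorem P_coe_rat : ((S.P : ℕ) : ℚ) = (S.p₁ : ℚ) * S.Q := by
  exact_mod_cast S.P_coe

/-- `conj(amp7 j k)·amp7 j′ k = e((j² − j′²)/P)`: the `k`-phases cancel. [cite: ChenQuantumLattice2024, eq. (35) p. 31] -/
theorem conj_amp7_mul_amp7 (j j' : ℕ) (k : Fin S.n → Fin 2) :
    (starRingEnd ℂ) (S.amp7 j k) * S.amp7 j' k = e ((((j : ℚ)) ^ 2 - ((j' : ℚ)) ^ 2) / S.P) := by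
  unfold amp7
  rw [map_mul, conj_e, conj_e,
    show ∀ a b c d : ℂ, a * b * (c * d) = (a * c) * (b * d) from fun a b c d => by ring,
    ← e_add, ← e_add, ← e_add]
  congr 1
  ring

/-- `|amp7 j k|² = 1`. [cite: ChenQuantumLattice2024, eq. (35) p. 31] -/
theorem conj_amp7_mul_self (j : ℕ) (k : Fin S.n → Fin 2) :
    (starRingEnd ℂ) (S.amp7 j k) * S.amp7 j k = 1 := by
  rw [conj_amp7_mul_amp7, sub_self, zero_div]
  have h0 := e_intCast 0
  rwa [Int.cast_zero] at h0

/-- The amplitude product of Move C: if `j = j′ + p₁a − Pc` and `Q ∣ j′` then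
`conj(amp7 j k)·amp7 j′ k = e(p₁a²/Q)` — independent of the branch. [cite: ChenQuantumLattice2024, eq. (35) p. 31, Cond. C.3 p. 18] -/
theorem conj_amp7_mul_amp7_moveC {j j' : ℕ} (k : Fin S.n → Fin 2) (a c s' : ℤ)
    (hj : (j : ℤ) = j' + S.p₁ * a - S.P * c) (hj' : (j' : ℤ) = S.Q * s') :
    (starRingEnd ℂ) (S.amp7 j k) * S.amp7 j' k = e ((S.p₁ : ℚ) * a ^ 2 / S.Q) := by
  rw [conj_amp7_mul_amp7]
  apply e_eq_e_of_sub_eq_intCast (2 * s' * a - 2 * S.Q * s' * c - 2 * S.p₁ * a * c + S.P * c ^ 2)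
  have hjQ : (j : ℚ) = j' + S.p₁ * a - S.P * c := by exact_mod_cast hj
  have hj'Q : (j' : ℚ) = S.Q * s' := by exact_mod_cast hj'
  rw [hjQ, hj'Q]
  push_cast
  rw [S.P_coe_rat]
  have hQ : ((S.Q : ℕ) : ℚ) ≠ 0 := by exact_mod_cast S.Q.ne_zero
  have hp : ((S.p₁ : ℕ) : ℚ) ≠ 0 := by exact_mod_cast S.p₁.ne_zero
  field_simp
  ring

/-! ### Inner products of the measured states of two instances -/

variable {S}

/-- `|φ7.d⟩` of an instance depends on the offset only modulo `M`. [cite: ChenQuantumLattice2024, §3.5.8 pp. 32–33] -/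
theorem phi7d_inst_congr (b v₂ v₃ : Fin (S.n + 1) → ℤ)
    (hv : ∀ i, ((v₃ i : ℤ) : ZMod S.M) = ((v₂ i : ℤ) : ZMod S.M)) :
    (S.inst b v₃).phi7d = (S.inst b v₂).phi7d := by
  show qft (n := S.n + 1) (m := (S.M : ℕ)) (kick S.kick8 (S.divideByD (domainExt (S.D : ℕ) (S.inst b v₃).phi7)))
    = qft (n := S.n + 1) (m := (S.M : ℕ)) (kick S.kick8 (S.divideByD (domainExt (S.D : ℕ) (S.inst b v₂).phi7)))
  rw [S.phi7_inst_congr b v₂ v₃ hv]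

/-- Step 8's operations scale inner products: `⟨φ7.d(b₂,v₂)|φ7.d(b₃,v₃)⟩ = M^{n+1}·⟨φ7.b(b₂,v₂)|φ7.b(b₃,v₃)⟩`
(QFT: polarised Plancherel; the kick is unimodular). [cite: ChenQuantumLattice2024, Lemma 2.12 p. 12, Lemma 2.13 p. 13, §3.5.8 p. 33] -/
theorem dot_phi7d_inst (b₂ v₂ b₃ v₃ : Fin (S.n + 1) → ℤ) :
    star (S.inst b₂ v₂).phi7d ⬝ᵥ (S.inst b₃ v₃).phi7d
      = ((S.M : ℕ) : ℂ) ^ (S.n + 1) * (star (S.inst b₂ v₂).phi7b ⬝ᵥ (S.inst b₃ v₃).phi7b) := by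
  show star (qft (n := S.n + 1) (m := (S.M : ℕ)) (kick S.kick8 (S.inst b₂ v₂).phi7b))
      ⬝ᵥ qft (n := S.n + 1) (m := (S.M : ℕ)) (kick S.kick8 (S.inst b₃ v₃).phi7b) = _
  rw [dotProduct_qft_qft, dotProduct_kick_kick]
  rfl

/-- **Rigidity ⇒ non-orthogonality.**  If at every coincidence of a branch `(j,k)` of `|φ7(b₂,v₂)⟩` with a
branch `(j′,k′)` of `|φ7(b₃,v₃)⟩` the amplitude product `conj(amp7 j k)·amp7 j′ k′` equals one `ζ ≠ 0`, and one
coincidence exists, then `⟨φ7.d(b₂,v₂)|φ7.d(b₃,v₃)⟩ ≠ 0`. [cite: ChenQuantumLattice2024, eq. (35) p. 31, §3.5.8 p. 33] -/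
theorem dot_phi7d_ne_zero_of_rigid {b₂ v₂ b₃ v₃ : Fin (S.n + 1) → ℤ} (h₂ : (S.inst b₂ v₂).Admissible)
    (h₃ : (S.inst b₃ v₃).Admissible) {ζ : ℂ} (hζ : ζ ≠ 0)
    (hrig : ∀ (j : ℕ) (k : Fin S.n → Fin 2) (j' : ℕ) (k' : Fin S.n → Fin 2), j < (S.P : ℕ) → j' < (S.P : ℕ) →
      (S.inst b₂ v₂).pt7 j k = (S.inst b₃ v₃).pt7 j' k' →
        (starRingEnd ℂ) (S.amp7 j k) * S.amp7 j' k' = ζ)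
    (hwit : ∃ (j : ℕ) (k : Fin S.n → Fin 2) (j' : ℕ) (k' : Fin S.n → Fin 2), j < (S.P : ℕ) ∧ j' < (S.P : ℕ) ∧
      (S.inst b₂ v₂).pt7 j k = (S.inst b₃ v₃).pt7 j' k') :
    star (S.inst b₂ v₂).phi7d ⬝ᵥ (S.inst b₃ v₃).phi7d ≠ 0 := by
  rw [dot_phi7d_inst]
  refine mul_ne_zero (pow_ne_zero _ (by exact_mod_cast S.M.ne_zero)) ?_
  apply dotProduct_ne_zero_of_rigid _ _ hζ
  · intro y hy₂ hy₃
    simp only [Shape.phi7b_apply] at hy₂ hy₃ ⊢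
    obtain ⟨j, hj, k, hjk⟩ := (S.inst b₂ v₂).exists_branch_of_phi7_ne_zero hy₂
    obtain ⟨j', hj', k', hjk'⟩ := (S.inst b₃ v₃).exists_branch_of_phi7_ne_zero hy₃
    have hco : (S.inst b₂ v₂).pt7 j k = (S.inst b₃ v₃).pt7 j' k' := hjk.symm.trans hjk'
    rw [hjk, hjk', (S.inst b₂ v₂).phi7_apply_pt7 h₂ hj, (S.inst b₃ v₃).phi7_apply_pt7 h₃ hj']
    exact hrig j k j' k' hj hj' hco
  · obtain ⟨j, k, j', k', hj, hj', hco⟩ := hwit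
    have hz : (fun i => (((S.D : ℕ) : ZMod S.M)) * ((((S.inst b₂ v₂).ctr j k i : ℤ)) : ZMod S.M))
        = (S.inst b₂ v₂).pt7 j k := by
      rw [(S.inst b₂ v₂).pt7_eq_D_mul_ctr h₂]
      funext i
      push_cast
      rfl
    refine ⟨fun i => ((((S.inst b₂ v₂).ctr j k i : ℤ)) : ZMod S.M), ?_, ?_⟩
    · have e2 : (S.inst b₂ v₂).phi7b (fun i => ((((S.inst b₂ v₂).ctr j k i : ℤ)) : ZMod S.M))
          = (S.inst b₂ v₂).amp7 j k := by
        rw [Shape.phi7b_apply]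
        exact (congrArg (S.inst b₂ v₂).phi7 hz).trans ((S.inst b₂ v₂).phi7_apply_pt7 h₂ hj k)
      rw [e2]
      exact (S.inst b₂ v₂).amp7_ne_zero j k
    · have e3 : (S.inst b₃ v₃).phi7b (fun i => ((((S.inst b₂ v₂).ctr j k i : ℤ)) : ZMod S.M))
          = (S.inst b₃ v₃).amp7 j' k' := by
        rw [Shape.phi7b_apply]
        exact (congrArg (S.inst b₃ v₃).phi7 (hz.trans hco)).trans ((S.inst b₃ v₃).phi7_apply_pt7 h₃ hj' k')
      rw [e3]
      exact (S.inst b₃ v₃).amp7_ne_zero j' k'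

/-- `j, j′ ∈ [0,P)` and `P ∣ j′ − j` force `j = j′`. [folklore] -/
theorem nat_eq_of_dvd_sub_of_lt {P j j' : ℕ} (hj : j < P) (hj' : j' < P) (hd : (P : ℤ) ∣ (j' : ℤ) - j) :
    j = j' := by
  have h0 := Int.eq_zero_of_abs_lt_dvd hd (abs_sub_lt_iff.2 ⟨by omega, by omega⟩)
  omega

/-- `1 < P` for an admissible shape (`P = p₁Q ≥ 9`). [cite: ChenQuantumLattice2024, Cond. C.3 p. 18] -/
theorem one_lt_P (h : S.Admissible) : 1 < (S.P : ℕ) := by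
  have hP : (S.P : ℕ) = S.p₁ * S.Q := by
    show (((S.p₁ * S.Q : ℕ+)) : ℕ) = _
    rw [PNat.mul_coe]
  have h1 := h.three_le_p₁
  have h2 := h.three_le_Q
  rw [hP]
  nlinarith

/-! ### The three moves -/

/-- **Move A — the secret is invisible at `j = 0`.**  Two admissible instances with the SAME offset `v` (and
any `b₂, b₃ ∈ −1|2p₁ℤⁿ`) have non-orthogonal `|φ7.d⟩`: a coincidence of branches has `(j,k) = (j′,k′)`
(coordinate `0`: `P ∣ j′ − j`; tails: `k = k′`), so the amplitude product is `1`, and the branch `j = 0` (whose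
point `v + (M/2)k` does not involve `b`) is common. [cite: ChenQuantumLattice2024, eq. (35) p. 31, eq. (12) p. 17] -/
theorem dot_phi7d_ne_zero_same_offset (h : S.Admissible) {b₂ b₃ v : Fin (S.n + 1) → ℤ}
    (h₂ : (S.inst b₂ v).Admissible) (h₃ : (S.inst b₃ v).Admissible) :
    star (S.inst b₂ v).phi7d ⬝ᵥ (S.inst b₃ v).phi7d ≠ 0 := by
  refine dot_phi7d_ne_zero_of_rigid h₂ h₃ one_ne_zero ?_ ?_
  · intro j k j' k' hj hj' hco
    have hk : k = k' := coincidence_k (S.odd_P h) hco fun t => ⟨0, by ring⟩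
    have hd := coincidence_head hco h₂.b_head h₃.b_head 0 (by ring)
    rw [sub_zero] at hd
    have hjj : j = j' := nat_eq_of_dvd_sub_of_lt hj hj' hd
    subst hk hjj
    exact S.conj_amp7_mul_self j k
  · refine ⟨0, fun _ => 0, 0, fun _ => 0, S.P.pos, S.P.pos, ?_⟩
    funext i
    rw [pt7_inst_apply, pt7_inst_apply]
    push_cast
    ring

/-- **Move T — tails.**  For `m ∈ ℤ^{n+1}` with `m₀ = 0`, the instances `(b, v)` and `(b − 2p₁m, v + 4D²p₁m)`
have non-orthogonal `|φ7.d⟩`: a coincidence has `(j,k) = (j′,k′)` (the offsets differ by an element of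
`4D²p₁ℤ ⊂ 2D²ℤ`, not at all on coordinate `0`), and the branch `j = 1` is common
(`2D²(b − 2p₁m) + 4D²p₁m = 2D²b`). [cite: ChenQuantumLattice2024, eq. (35) p. 31, eq. (12) p. 17] -/
theorem dot_phi7d_ne_zero_moveT (h : S.Admissible) {b v : Fin (S.n + 1) → ℤ} (hI : (S.inst b v).Admissible)
    (m : Fin (S.n + 1) → ℤ) (hm : m 0 = 0) :
    star (S.inst b v).phi7d ⬝ᵥ
      (S.inst (fun i => b i - 2 * (S.p₁ : ℤ) * m i)
        (fun i => v i + 4 * (S.D : ℤ) * S.D * S.p₁ * m i)).phi7d ≠ 0 := by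
  have hb0 : b 0 = -1 := hI.b_head
  have h₃ : (S.inst (fun i => b i - 2 * (S.p₁ : ℤ) * m i)
      (fun i => v i + 4 * (S.D : ℤ) * S.D * S.p₁ * m i)).Admissible := by
    refine S.inst_admissible h ?_ (fun i hi => ?_) (fun i => ?_)
    · show b 0 - 2 * (S.p₁ : ℤ) * m 0 = -1
      rw [hm, hb0]
      ring
    · exact dvd_sub (hI.b_tail i hi) ⟨m i, by ring⟩
    · exact dvd_add (hI.v'_in_DZ i) ⟨4 * S.D * S.p₁ * m i, by ring⟩
  refine dot_phi7d_ne_zero_of_rigid hI h₃ one_ne_zero ?_ ?_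
  · intro j k j' k' hj hj' hco
    have hk : k = k' :=
      coincidence_k (S.odd_P h) hco fun t => ⟨2 * S.p₁ * m t.succ, by ring⟩
    have hd := coincidence_head hco hb0 (by show b 0 - 2 * (S.p₁ : ℤ) * m 0 = -1; rw [hm, hb0]; ring) 0
      (by show v 0 + 4 * (S.D : ℤ) * S.D * S.p₁ * m 0 - v 0 = _; rw [hm]; ring)
    rw [sub_zero] at hd
    have hjj : j = j' := nat_eq_of_dvd_sub_of_lt hj hj' hd
    subst hk hjj
    exact S.conj_amp7_mul_self j k
  · refine ⟨1, fun _ => 0, 1, fun _ => 0, S.one_lt_P h, S.one_lt_P h, ?_⟩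
    funext i
    rw [pt7_inst_apply, pt7_inst_apply]
    push_cast
    ring

/-- **Move C — the move that changes `v′₀`.**  For a coordinate `t₁+1` and `a ∈ ℤ`, the instances `(b, v)` and
`(b − 2p₁e_{t₁+1}, v + 2D²p₁a·b)` (whose offset differs by `−2D²p₁a` on coordinate `0`) have non-orthogonal
`|φ7.d⟩`: at a coincidence, coordinate `0` forces `j = j′ + p₁a − Pc`, the tails force `k = k′`, and coordinate
`t₁+1` (where `b` dropped by `2p₁`) forces `P ∣ 2p₁j′`, i.e. `Q ∣ j′` (`Q` odd); hence the amplitude product is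
ALWAYS `e(p₁a²/Q)`; and the branches `j = p₁a mod P`, `j′ = 0` coincide. (Shifting `v` along `b` WITHOUT
changing `b` gives orthogonal states for `Q ∤ a`: then `j′` is free and `Σ_{j′} e(2aj′/Q) = 0`.)
[cite: ChenQuantumLattice2024, eq. (35) p. 31, eq. (12) p. 17, Cond. C.3 p. 18] -/
theorem dot_phi7d_ne_zero_moveC (h : S.Admissible) {b v : Fin (S.n + 1) → ℤ} (hI : (S.inst b v).Admissible)
    (t₁ : Fin S.n) (a : ℤ) :
    star (S.inst b v).phi7d ⬝ᵥ
      (S.inst (Function.update b t₁.succ (b t₁.succ - 2 * (S.p₁ : ℤ)))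
        (fun i => v i + 2 * (S.D : ℤ) * S.D * S.p₁ * a * b i)).phi7d ≠ 0 := by
  have hb0 : b 0 = -1 := hI.b_head
  have hb'0 : Function.update b t₁.succ (b t₁.succ - 2 * (S.p₁ : ℤ)) 0 = -1 := by
    rw [Function.update_of_ne (Fin.succ_ne_zero t₁).symm, hb0]
  have hb't : Function.update b t₁.succ (b t₁.succ - 2 * (S.p₁ : ℤ)) t₁.succ = b t₁.succ - 2 * (S.p₁ : ℤ) :=
    Function.update_self _ _ _
  have h₃ : (S.inst (Function.update b t₁.succ (b t₁.succ - 2 * (S.p₁ : ℤ)))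
      (fun i => v i + 2 * (S.D : ℤ) * S.D * S.p₁ * a * b i)).Admissible := by
    refine S.inst_admissible h hb'0 (fun i hi => ?_) (fun i => ?_)
    · by_cases hit : i = t₁.succ
      · subst hit
        rw [hb't]
        exact dvd_sub (hI.b_tail _ hi) ⟨1, by ring⟩
      · rw [Function.update_of_ne hit]
        exact hI.b_tail i hi
    · exact dvd_add (hI.v'_in_DZ i) ⟨2 * S.D * S.p₁ * a * b i, by ring⟩
  have hP0 : (0 : ℤ) < (S.P : ℕ) := by exact_mod_cast S.P.pos
  refine dot_phi7d_ne_zero_of_rigid hI h₃ (ζ := e ((S.p₁ : ℚ) * a ^ 2 / S.Q))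
    (by unfold e; exact Complex.exp_ne_zero _) ?_ ?_
  · intro j k j' k' hj hj' hco
    have hk : k = k' :=
      coincidence_k (S.odd_P h) hco fun t => ⟨S.p₁ * a * b t.succ, by ring⟩
    obtain ⟨c, hc⟩ := coincidence_head hco hb0 hb'0 (-(S.p₁ * a))
      (by show v 0 + 2 * (S.D : ℤ) * S.D * S.p₁ * a * b 0 - v 0 = _; rw [hb0]; ring)
    obtain ⟨d, hd⟩ := coincidence_tail hco t₁ (congr_fun hk t₁) (S.p₁ * a * b t₁.succ) (by ring)
    rw [hb't] at hd
    have hP := S.P_coe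
    have hu : 2 * (j' : ℤ) = S.Q * (d + b t₁.succ * c) := by
      have hp : ((S.p₁ : ℕ) : ℤ) ≠ 0 := by exact_mod_cast S.p₁.ne_zero
      refine mul_left_cancel₀ hp ?_
      linear_combination hd + (b t₁.succ) * hc + (d + b t₁.succ * c) * hP
    obtain ⟨r, hr⟩ := h.odd_Q
    have hQ : ((S.Q : ℕ) : ℤ) = 2 * r + 1 := by exact_mod_cast hr
    have hj'Q : (j' : ℤ) = S.Q * ((r + 1) * (d + b t₁.succ * c) - j') := by
      linear_combination (r + 1 : ℤ) * hu + (j' : ℤ) * hQ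
    have hjj : (j : ℤ) = j' + S.p₁ * a - S.P * c := by linear_combination (-1 : ℤ) * hc
    subst hk
    exact S.conj_amp7_mul_amp7_moveC k a c _ hjj hj'Q
  · have hj0 : (0 : ℤ) ≤ ((S.p₁ : ℤ) * a) % (S.P : ℕ) := Int.emod_nonneg _ hP0.ne'
    have hjlt' : (((S.p₁ : ℤ) * a) % (S.P : ℕ)) < (S.P : ℕ) := Int.emod_lt_of_pos _ hP0
    refine ⟨(((S.p₁ : ℤ) * a) % (S.P : ℕ)).toNat, fun _ => 0, 0, fun _ => 0, ?_, S.P.pos, ?_⟩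
    · have := Int.toNat_of_nonneg hj0
      omega
    · have hjP : ((((S.p₁ : ℤ) * a) % (S.P : ℕ)).toNat : ℤ)
          = S.p₁ * a - (S.P : ℕ) * (((S.p₁ : ℤ) * a) / (S.P : ℕ)) := by
        rw [Int.toNat_of_nonneg hj0, Int.emod_def]
      funext i
      rw [pt7_inst_apply, pt7_inst_apply]
      refine (ZMod.intCast_eq_intCast_iff_dvd_sub _ _ (S.M : ℕ)).2 ?_
      rw [S.M_coe]
      refine ⟨b i * (((S.p₁ : ℤ) * a) / (S.P : ℕ)), ?_⟩
      push_cast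
      linear_combination (-2 * (S.D : ℤ) * S.D * b i) * hjP

/-! ### The class of instances a Step-8 measurement must serve, and the ceiling -/

variable (S)

/-- The instances CONSISTENT WITH THE PUBLIC DATA: same `n, D, p₁, Q` (and Step-9 data), `b₂` agreeing with
`b` off the set `U` of unknown coordinates (eq. (12): the planted coordinates `2p₁p₂, …, 2p₁p_κ` are public,
the secret and error coordinates are not), and admissible (`b₂ ∈ −1|2p₁ℤⁿ`, `v₂ ∈ Dℤ^{n+1}` — a
measurement history, eq. (35)). [cite: ChenQuantumLattice2024, eq. (12) p. 17, eq. (35) p. 31] -/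
def InClass (U : Finset (Fin (S.n + 1))) (b₂ v₂ : Fin (S.n + 1) → ℤ) : Prop :=
  (∀ i, i ∉ U → b₂ i = S.b i) ∧ (S.inst b₂ v₂).Admissible

/-- A general measurement of the Step-8 register is SURE on the class if it has a certain outcome on
`|φ7.d⟩` of every instance of the class — what Lemma 3.13 needs of the fifth operation of Step 8 so that
`|φ8⟩ = |φ7⟩` ("this measurement does not collapse the state", p. 34).
[cite: ChenQuantumLattice2024, Lemma 3.13 pp. 32–34] -/
def SureOn {κ : Type*} [Fintype κ] (U : Finset (Fin (S.n + 1)))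
    (E : POVM (Fin (S.n + 1) → ZMod S.M) κ) : Prop :=
  ∀ b₂ v₂ : Fin (S.n + 1) → ℤ, S.InClass U b₂ v₂ → ∃ k, E.Certain (S.inst b₂ v₂).phi7d k

/-- **The general-measurement ceiling of Step 8.**  Let `U ∋ t₁+1` be the unknown coordinates and `E` any POVM
sure on the class.  For instances `(b₂,v₂)`, `(b₃,v₃)` of the class with
`v₃ ≡ v₂ + 2D²p₁(a·b₂ + m) (mod M)` (`a ∈ ℤ`, `m ∈ ℤ^{n+1}` supported on `U ∖ {0}`), the certain outcomes on
`|φ7.d(b₂,v₂)⟩` and `|φ7.d(b₃,v₃)⟩` are equal.  Chain: `(b₂,v₂) ~C~ (b₂−2p₁e_{t₁+1}, v₂+2D²p₁ab₂) ~A~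
(b₂, v₂+2D²p₁ab₂) ~T~ (b₂−2p₁m′, … + 4D²p₁m′) ~A~ (b₃, same)` with `m′ = ((Q+1)/2)·m`
(`4D²p₁m′ ≡ 2D²p₁m (mod M)`), each link by `POVM.eq_of_certain_of_dotProduct_ne_zero`.
[cite: ChenQuantumLattice2024, Lemma 3.13 pp. 32–34, eq. (12) p. 17, eq. (35) p. 31] -/
theorem step8_povm_ceiling (h : S.Admissible) {κ : Type*} [Fintype κ] [DecidableEq κ]
    (U : Finset (Fin (S.n + 1))) (t₁ : Fin S.n) (ht₁ : t₁.succ ∈ U)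
    (E : POVM (Fin (S.n + 1) → ZMod S.M) κ) (hE : S.SureOn U E)
    {b₂ v₂ b₃ v₃ : Fin (S.n + 1) → ℤ} (hI₂ : S.InClass U b₂ v₂) (hI₃ : S.InClass U b₃ v₃)
    (a : ℤ) (m : Fin (S.n + 1) → ℤ) (hm0 : m 0 = 0) (hmU : ∀ i, i ∉ U → m i = 0)
    (hv : ∀ i, ((v₃ i : ℤ) : ZMod S.M)
      = ((v₂ i + 2 * (S.D : ℤ) * S.D * S.p₁ * (a * b₂ i + m i) : ℤ) : ZMod S.M))
    {k₂ k₃ : κ} (hk₂ : E.Certain (S.inst b₂ v₂).phi7d k₂) (hk₃ : E.Certain (S.inst b₃ v₃).phi7d k₃) :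
    k₂ = k₃ := by
  obtain ⟨hb₂U, h₂⟩ := hI₂
  obtain ⟨hb₃U, h₃⟩ := hI₃
  have hb₂0 : b₂ 0 = -1 := h₂.b_head
  have hb₃0 : b₃ 0 = -1 := h₃.b_head
  obtain ⟨r, hr⟩ := h.odd_Q
  have hQ : ((S.Q : ℕ) : ℤ) = 2 * r + 1 := by exact_mod_cast hr
  -- the chain
  let bC : Fin (S.n + 1) → ℤ := Function.update b₂ t₁.succ (b₂ t₁.succ - 2 * (S.p₁ : ℤ))
  let vC : Fin (S.n + 1) → ℤ := fun i => v₂ i + 2 * (S.D : ℤ) * S.D * S.p₁ * a * b₂ i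
  let m' : Fin (S.n + 1) → ℤ := fun i => ((r : ℤ) + 1) * m i
  let bT : Fin (S.n + 1) → ℤ := fun i => b₂ i - 2 * (S.p₁ : ℤ) * m' i
  let vT : Fin (S.n + 1) → ℤ := fun i => vC i + 4 * (S.D : ℤ) * S.D * S.p₁ * m' i
  have hm'0 : m' 0 = 0 := by show ((r : ℤ) + 1) * m 0 = 0; rw [hm0, mul_zero]
  have hvC : ∀ i, (S.D : ℤ) ∣ vC i := fun i =>
    dvd_add (h₂.v'_in_DZ i) ⟨2 * S.D * S.p₁ * a * b₂ i, by ring⟩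
  have hvT : ∀ i, (S.D : ℤ) ∣ vT i := fun i =>
    dvd_add (hvC i) ⟨4 * S.D * S.p₁ * m' i, by ring⟩
  -- admissibility and class membership of the intermediate instances
  have aC : (S.inst bC vC).Admissible := by
    refine S.inst_admissible h ?_ (fun i hi => ?_) hvC
    · show Function.update b₂ t₁.succ (b₂ t₁.succ - 2 * (S.p₁ : ℤ)) 0 = -1
      rw [Function.update_of_ne (Fin.succ_ne_zero t₁).symm, hb₂0]
    · show (2 * (S.p₁ : ℤ)) ∣ Function.update b₂ t₁.succ (b₂ t₁.succ - 2 * (S.p₁ : ℤ)) i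
      by_cases hit : i = t₁.succ
      · subst hit
        rw [Function.update_self]
        exact dvd_sub (h₂.b_tail _ hi) ⟨1, by ring⟩
      · rw [Function.update_of_ne hit]
        exact h₂.b_tail i hi
  have cC : S.InClass U bC vC := by
    refine ⟨fun i hi => ?_, aC⟩
    have hit : i ≠ t₁.succ := fun e => hi (e ▸ ht₁)
    show Function.update b₂ t₁.succ (b₂ t₁.succ - 2 * (S.p₁ : ℤ)) i = S.b i
    rw [Function.update_of_ne hit, hb₂U i hi]
  have a₂C : (S.inst b₂ vC).Admissible := S.inst_admissible h hb₂0 h₂.b_tail hvC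
  have c₂C : S.InClass U b₂ vC := ⟨hb₂U, a₂C⟩
  have aT : (S.inst bT vT).Admissible := by
    refine S.inst_admissible h ?_ (fun i hi => ?_) hvT
    · show b₂ 0 - 2 * (S.p₁ : ℤ) * m' 0 = -1
      rw [hm'0, hb₂0]
      ring
    · exact dvd_sub (h₂.b_tail i hi) ⟨m' i, by ring⟩
  have cT : S.InClass U bT vT := by
    refine ⟨fun i hi => ?_, aT⟩
    show b₂ i - 2 * (S.p₁ : ℤ) * (((r : ℤ) + 1) * m i) = S.b i
    rw [hmU i hi, hb₂U i hi]
    ring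
  have a₃T : (S.inst b₃ vT).Admissible := S.inst_admissible h hb₃0 h₃.b_tail hvT
  have c₃T : S.InClass U b₃ vT := ⟨hb₃U, a₃T⟩
  -- the sure outcomes along the chain
  obtain ⟨o₁, ho₁⟩ := hE bC vC cC
  obtain ⟨o₂, ho₂⟩ := hE b₂ vC c₂C
  obtain ⟨o₃, ho₃⟩ := hE bT vT cT
  obtain ⟨o₄, ho₄⟩ := hE b₃ vT c₃T
  -- the links
  have l₁ : k₂ = o₁ :=
    E.eq_of_certain_of_dotProduct_ne_zero hk₂ ho₁ (S.dot_phi7d_ne_zero_moveC h h₂ t₁ a)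
  have l₂ : o₁ = o₂ :=
    E.eq_of_certain_of_dotProduct_ne_zero ho₁ ho₂ (S.dot_phi7d_ne_zero_same_offset h aC a₂C)
  have l₃ : o₂ = o₃ :=
    E.eq_of_certain_of_dotProduct_ne_zero ho₂ ho₃ (S.dot_phi7d_ne_zero_moveT h a₂C m' hm'0)
  have l₄ : o₃ = o₄ :=
    E.eq_of_certain_of_dotProduct_ne_zero ho₃ ho₄ (S.dot_phi7d_ne_zero_same_offset h aT a₃T)
  -- the last instance has the same state as `(b₃, v₃)`
  have hcong : ∀ i, ((vT i : ℤ) : ZMod S.M) = ((v₃ i : ℤ) : ZMod S.M) := by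
    intro i
    rw [hv i, ZMod.intCast_eq_intCast_iff_dvd_sub, S.M_coe]
    refine ⟨-(m i), ?_⟩
    show v₂ i + 2 * (S.D : ℤ) * S.D * S.p₁ * (a * b₂ i + m i)
        - (v₂ i + 2 * (S.D : ℤ) * S.D * S.p₁ * a * b₂ i + 4 * (S.D : ℤ) * S.D * S.p₁ * (((r : ℤ) + 1) * m i))
        = 2 * (S.D : ℤ) * S.D * S.P * -m i
    have hP := S.P_coe
    linear_combination (2 * (S.D : ℤ) * S.D * m i) * hP + (2 * (S.D : ℤ) * S.D * S.p₁ * m i) * hQ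
  have hstate : (S.inst b₃ vT).phi7d = (S.inst b₃ v₃).phi7d := S.phi7d_inst_congr b₃ v₃ vT hcong
  rw [← hstate] at hk₃
  have l₅ : o₄ = k₃ := E.certain_unique ((S.inst b₃ vT).phi7d_ne_zero a₃T) ho₄ hk₃
  rw [l₁, l₂, l₃, l₄, l₅]

/-- **Corollary: no measurement of the Step-8 register supplies what Step 9 consumes.**  For any set of unknown
coordinates `U ∋ t₁+1` and any POVM sure on the class, the admissible instance `(b, v′ + 2D²p₁b)` — SAME `b`,
same `step8Output = v′₀ mod D²p₁`, DIFFERENT `step9Needs = v′₀ mod D²P` (its `v′₀` is `v′₀ − 2D²p₁`, and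
`Q ∤ 2`) — receives the same certain outcome as `S`. [cite: ChenQuantumLattice2024, Lemma 3.13 p. 32, §3.5.9 p. 37] -/
theorem step8_cannot_supply_step9Needs_povm (h : S.Admissible) {κ : Type*} [Fintype κ] [DecidableEq κ]
    (U : Finset (Fin (S.n + 1))) (t₁ : Fin S.n) (ht₁ : t₁.succ ∈ U)
    (E : POVM (Fin (S.n + 1) → ZMod S.M) κ) (hE : S.SureOn U E) :
    ∃ v₃ : Fin (S.n + 1) → ℤ, (S.inst S.b v₃).Admissible
      ∧ (S.inst S.b v₃).step8Output = S.step8Output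
      ∧ (S.inst S.b v₃).step9Needs ≠ S.step9Needs
      ∧ ∀ k k' : κ, E.Certain S.phi7d k → E.Certain (S.inst S.b v₃).phi7d k' → k = k' := by
  have h₃ : (S.inst S.b (fun i => S.v' i + 2 * (S.D : ℤ) * S.D * S.p₁ * S.b i)).Admissible :=
    S.inst_admissible h h.b_head h.b_tail fun i =>
      dvd_add (h.v'_in_DZ i) ⟨2 * S.D * S.p₁ * S.b i, by ring⟩
  refine ⟨fun i => S.v' i + 2 * (S.D : ℤ) * S.D * S.p₁ * S.b i, h₃, ?_, ?_, ?_⟩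
  · show (((S.v' 0 + 2 * (S.D : ℤ) * S.D * S.p₁ * S.b 0 : ℤ)) : ZMod ((S.D : ℕ) ^ 2 * S.p₁))
        = ((S.v' 0 : ℤ) : ZMod ((S.D : ℕ) ^ 2 * S.p₁))
    rw [ZMod.intCast_eq_intCast_iff_dvd_sub, h.b_head]
    exact ⟨2, by push_cast; ring⟩
  · show (((S.v' 0 + 2 * (S.D : ℤ) * S.D * S.p₁ * S.b 0 : ℤ)) : ZMod S.N) ≠ ((S.v' 0 : ℤ) : ZMod S.N)
    rw [Ne, ZMod.intCast_eq_intCast_iff_dvd_sub, h.b_head, S.N_coe, S.P_coe]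
    rintro ⟨c, hc⟩
    have hD : (0 : ℤ) < S.D := by exact_mod_cast S.D.pos
    have hp : (0 : ℤ) < S.p₁ := by exact_mod_cast S.p₁.pos
    have hQ3 : (3 : ℤ) ≤ S.Q := by exact_mod_cast h.three_le_Q
    have hc' : (S.D : ℤ) * S.D * S.p₁ * (2 - S.Q * c) = 0 := by linear_combination hc
    have h2 : (2 : ℤ) - S.Q * c = 0 := by
      rcases mul_eq_zero.1 hc' with h1 | h1
      · exfalso
        have : (0 : ℤ) < (S.D : ℤ) * S.D * S.p₁ := by positivity
        exact this.ne' h1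
      · exact h1
    have : (S.Q : ℤ) * c = 2 := by linarith
    rcases lt_trichotomy c 0 with hc0 | hc0 | hc0
    · nlinarith
    · rw [hc0, mul_zero] at this
      norm_num at this
    · nlinarith
  · intro k k' hk hk'
    have hS : S.InClass U S.b S.v' := ⟨fun _ _ => rfl, h⟩
    have hS₃ : S.InClass U S.b (fun i => S.v' i + 2 * (S.D : ℤ) * S.D * S.p₁ * S.b i) :=
      ⟨fun _ _ => rfl, h₃⟩
    exact S.step8_povm_ceiling h U t₁ ht₁ E hE hS hS₃ 1 (fun _ => 0) rfl (fun _ _ => rfl)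
      (fun i => by push_cast; ring) hk hk'

/-- The same corollary for the full class of `step8_information_ceiling` (every coordinate `≥ 1` unknown,
`n ≥ 1`). [cite: ChenQuantumLattice2024, Lemma 3.13 p. 32, §3.5.9 p. 37] -/
theorem step8_cannot_supply_step9Needs_povm' (h : S.Admissible) (hn : 0 < S.n) {κ : Type*} [Fintype κ]
    [DecidableEq κ] (E : POVM (Fin (S.n + 1) → ZMod S.M) κ) (hE : S.SureOn Finset.univ E) :
    ∃ v₃ : Fin (S.n + 1) → ℤ, (S.inst S.b v₃).Admissible
      ∧ (S.inst S.b v₃).step8Output = S.step8Output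
      ∧ (S.inst S.b v₃).step9Needs ≠ S.step9Needs
      ∧ ∀ k k' : κ, E.Certain S.phi7d k → E.Certain (S.inst S.b v₃).phi7d k' → k = k' :=
  S.step8_cannot_supply_step9Needs_povm h Finset.univ ⟨0, hn⟩ (Finset.mem_univ _) E hE

/-! ### Computational read-outs are the special case -/

variable {S}

/-- Membership in the full class (`U = univ`) is admissibility. [cite: ChenQuantumLattice2024, eq. (12) p. 17, eq. (35) p. 31] -/
theorem inClass_univ {b₂ v₂ : Fin (S.n + 1) → ℤ} : S.InClass Finset.univ b₂ v₂ ↔ (S.inst b₂ v₂).Admissible :=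
  ⟨fun h => h.2, fun h => ⟨fun i hi => absurd (Finset.mem_univ i) hi, h⟩⟩

end Shape

namespace POVM

/-- The computational read-out of a statistic `F` of the outcome, as a POVM: `E_a = Σ_{w : F w = a} |w⟩⟨w|`
(compute `F` into an ancilla, measure it). [cite: NielsenChuang2010, §2.2.5 p. 87] -/
noncomputable def readout {X α : Type*} [Fintype X] [DecidableEq X] [Fintype α] [DecidableEq α]
    (F : X → α) : POVM X α where
  effect a := Matrix.diagonal fun w => if F w = a then 1 else 0
  posSemidef a := Matrix.PosSemidef.diagonal fun w => by
    dsimp only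
    split_ifs
    · exact zero_le_one
    · exact le_rfl
  sum_eq_one := by
    ext i j
    rw [Matrix.sum_apply]
    simp only [Matrix.diagonal_apply, Matrix.one_apply]
    split_ifs with hij
    · rw [Finset.sum_ite_eq]
      simp
    · simp

/-- A read-out's outcome `a` is certain on `ψ` iff `ψ` is supported in `F⁻¹(a)`. [cite: NielsenChuang2010, §2.2.5 p. 87] -/
theorem readout_certain_iff {X α : Type*} [Fintype X] [DecidableEq X] [Fintype α] [DecidableEq α]
    (F : X → α) (ψ : X → ℂ) (a : α) : (readout F).Certain ψ a ↔ ∀ w, ψ w ≠ 0 → F w = a := by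
  constructor
  · intro h w hw
    have h1 := congr_fun ((readout F).mulVec_eq_self_of_certain h) w
    simp only [readout, Matrix.mulVec_diagonal] at h1
    by_contra hne
    rw [if_neg hne, zero_mul] at h1
    exact hw h1.symm
  · intro h
    unfold Certain weight
    simp only [readout, Matrix.mulVec_diagonal, dotProduct, Pi.star_apply]
    refine Finset.sum_congr rfl fun w _ => ?_
    by_cases hw : ψ w = 0
    · rw [hw]
      simp
    · rw [if_pos (h w hw), one_mul]

/-- The hypothesis of `Shape.step8_information_ceiling` is the special case: a non-demolition statistic `F` of
the outcome is a read-out POVM sure on every class. [cite: ChenQuantumLattice2024, Lemma 3.13 pp. 32–34] -/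
theorem _root_.Literature.Computability.Cryptography.Chen2024.Shape.sureOn_readout_of_nonDemolition
    (S : Shape) {α : Type*} [Fintype α] [DecidableEq α] {F : (Fin (S.n + 1) → ZMod S.M) → α}
    (hF : S.NonDemolition F) (U : Finset (Fin (S.n + 1))) : S.SureOn U (readout F) := by
  intro b₂ v₂ hI
  have hne : (S.inst b₂ v₂).phi7d ≠ 0 := (S.inst b₂ v₂).phi7d_ne_zero hI.2
  obtain ⟨w₀, hw₀⟩ := Function.ne_iff.1 hne
  exact ⟨F w₀, (readout_certain_iff F _ _).2 fun w hw => hF b₂ v₂ hI.2 w w₀ hw hw₀⟩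

end POVM

end Literature.Computability.Cryptography.Chen2024
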